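import Summits.QuantumFields.YangMills.Theorems.UnitScaleTiltProp7FirstVariationFibreCurve
import Summits.QuantumFields.YangMills.Theorems.UnitScaleTiltProp7FibreVelocityIter
import Literature.Computability.Complexity.ProductWeights
import HarnessLib

/-!
# Route `UnitScaleTilt`, crux K1 child «MinimiserStabilityRegPr» (stmt-QuantumFields-19200) — «blend-ℓ²» line (OWNER RULING g24-№1 §B), stub S4
# `firstVariationFibre`, step (iii) AT THE d = 3 CARRIERS: **THE LAGRANGE-MULTIPLIER BOUND `|Lin_U(A)| ≤ 2·ε₀·L^{−(K−n)}·Σ_c ‖(d/ds)Ū^{(k)}(e^{sA}U)(c)|₀‖`**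
# — the first variation of the Wilson action at an R2-critical `U ∈ 𝔘_k(ε₀)` along ANY direction `A` is controlled by the CONSTRAINT VELOCITY of `A`
# (the velocity of the `k`-fold (0.4)-average), with the `k`-UNIFORM weight `2ε₀L^{−(K−n)}` = `‖J‖_∞ · ‖R_tree‖_{1→1}` = `ε₀L^{−3k} · 2L^{2k}`

Cell `ym3-torus` ∕ width seat `ym-ust-19200-w1` (gen 0; HUMAN RULING D-0037 — YM₃ on T³ is ladder rung R3, not the Clay problem).

WHY.  This is the «S4 algebra» of CARD-19200-V3-g9 §8 (`Lin_U(W^g) = −Λ·q₂(X) + …`, `‖Λ‖_∞ ≤ C·ε₀·η`), proved WITHOUT a multiplier object and without an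
implicit-function theorem: Euler–Lagrange along p2's corrected lift (`Prop7FirstVariationFibreCurve.exists_fibre_curve_lin_eq_zero_of_isCritR2`) gives
`Lin_U(ξ) = 0` for the lift velocity `ξ`, the current identity gives `|Lin_U(A)| ≤ ε₀L^{−3(K−n)}·Σ_b‖A_b − ξ_b‖`, and the `k`-fold a-posteriori corrector
bound (`Prop7FibreVelocity.sum_norm_deriv_sub_le_prod`, through the MINIMAL tower, with the GEOMETRIC smallness profile of `IterPlaqSmallAllL.plaqSmall_iter_T3_allL`)
gives `Σ_b‖A_b − ξ_b‖ ≤ [∏_{i<k}(L^{−2} − 148·stokesConst·t_i)⁻¹]·Σ_c‖D_c‖` with the product `≤ 2L^{2(K−n)}` uniformly in `k = K − n` (`prod_weight_le_T3`,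
Weierstrass' inequality over `Σ_i t_i = O(L⁵ε₀)`).  Here `D_c` is the velocity at `s = 0` of the `k`-fold average of the ambient family at the level-`k` bond `c`
(the lift's own `k`-fold average is constant `= V`).  What remains of S4 (steps (iv)–(v) of the refined plan): bound the constraint velocity `Σ_c‖D_c‖` of
`A = log(W′U^*)` for `W′` in the fibre by a second-order functional of `A` (the two-point defect `Ū^{(k)}(e^{sA}U) = V` at `s = 0, 1`), where the
representative's regularity ((R) of the card) enters.

WHAT IS PROVED (sorry-free, no definition).  §1 `exists_minimal_tower_of_top`, `exists_minimal_tower` (the minimal tower `T_i = β(T_{i+1})` with top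
`T_k = univ` exists).  §2 `prod_weight_le_T3` (the `k`-uniform product bound `≤ 2(L^{K−n})²` under `10¹⁰L⁶ε₀ ≤ 1`).  §3 **`abs_lin_le_constraint_velocity`**
(the title bound, for every bondwise differentiable ambient family `Γ₀` through `U` with velocities `A_bU(b)`).

HONEST SCOPE.  The multiplier∕tangency half of S4 only; the defect-velocity bound (iv) and the assembly (v) into schema (iii) of
`Prop7BlendClause1.atMostOneCriticalOrbit_of_reprSchema_T3` are NOT here.  Count-neutral helper toward stmt-QuantumFields-19200 (`--supports`); nothing
continuum ∕ OS ∕ mass-gap ∕ Clay.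

References: T. Bałaban, CMP **102** (1985) 277–309 [Balaban1985Variational] ((2), (6) p.278, (47)–(48) p.287, (127) p.297, (141)–(143) p.299); CMP **99** (1985)
389–434 [Balaban1985BackgroundPropagators] ((3.11) p.392); CMP **109** (1987) 249–301 [Balaban1987RG1] ((0.4), (0.11) p.253).
-/

noncomputable section

open scoped BigOperators Matrix.Norms.L2Operator Matrix Topology
open Filter NormedSpace

namespace Summit.QuantumFields.YangMills.Theorems.Prop7FirstVariationMultiplier

open Literature.MathematicalPhysics.QuantumFieldTheory.Balaban1983to89
open T4Continuum AveragingRT BlockAveraging BlockAveragingHaarAC BlockAveragingEMLHaarAC ExpMeanLog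
open T3ContinuumYM3Torus T3UnitLawDensityEML T3ConstrainedMinimiser T3TiltDescent T3DescentFibreTower T3LevelShift
open T3RegularMinimiser T3PrintedRegularMinimiser T3Thm1CarrierNative
open B10Eq27TorusAxialLog (unitsField toUField)
open B10Eq68TorusRegularity (covDivT)
open Summit.QuantumFields.YangMills.Theorems.BlockAvgCorrector (stokesConst stokesConst_nonneg stokesConst_T3 emlWeight_le_one)
open Summit.QuantumFields.YangMills.Theorems.Prop8CriticalityAllL (t0_data_of_regPr_allL)
open Summit.QuantumFields.YangMills.Theorems.IterPlaqSmallAllL (plaqSmall_iter_T3_allL)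
open Summit.QuantumFields.YangMills.Theorems.Prop7CovariantCoercivity (abs_re_trace_le)
open Summit.QuantumFields.YangMills.Theorems.Prop7FirstVariationCurrent (lin_eq_neg_half_sum_re_trace_mul_covDivT)
open Summit.QuantumFields.YangMills.Theorems.Prop7FirstVariationFibreCurve (exists_fibre_curve_lin_eq_zero_of_isCritR2)
open Summit.QuantumFields.YangMills.Theorems.Prop7FibreVelocity (sum_norm_deriv_sub_le_prod)

/-! ## §1 The minimal tower of the central-bond maps -/

section Tower

variable (P : Params)

/-- For every top level `k` and top set `S` of level-`k` bonds there is a tower `T` with `T_k = S` that is MINIMAL below `k`: `T_i = β(T_{i+1})` for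
`i < k` (downward recursion along the central-bond map `β` of (0.4)). [cite: Balaban1987RG1, (0.4), (0.11) p.253] -/
theorem exists_minimal_tower_of_top : ∀ (k : ℕ) (S : Set (PBond P k)), ∃ T : (i : ℕ) → Set (PBond P i),
    T k = S ∧ ∀ i, i < k → ∀ b : PBond P i, b ∈ T i ↔ ∃ c ∈ T (i + 1), centralBond c = b
  | 0, S => ⟨Function.update (fun i => (Set.univ : Set (PBond P i))) 0 S, Function.update_self .., fun i hi => absurd hi (Nat.not_lt_zero i)⟩
  | k + 1, S => by
    obtain ⟨T', hT'k, hT'⟩ := exists_minimal_tower_of_top k (centralBond '' S)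
    refine ⟨Function.update T' (k + 1) S, Function.update_self .., fun i hi b => ?_⟩
    rcases Nat.lt_succ_iff_lt_or_eq.mp hi with hik | rfl
    · rw [Function.update_of_ne (by omega), Function.update_of_ne (by omega)]
      exact hT' i hik b
    · rw [Function.update_of_ne (by omega), Function.update_self, hT'k, Set.mem_image]

/-- **THE MINIMAL TOWER WITH FULL TOP**: for every `k` a tower `T` with `T_k` = all level-`k` bonds, closed downwards under `β`, and minimal below `k`
(`T_i = β(T_{i+1})`, `i < k`); its bottom `T₀ = β^k(all)` is the iterated-central «tree» on which p2's corrected lift moves the ambient family.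
[cite: Balaban1987RG1, (0.4), (0.11) p.253; Balaban1985Variational, (47) p.287] -/
theorem exists_minimal_tower (k : ℕ) : ∃ T : (i : ℕ) → Set (PBond P i),
    (∀ c : PBond P k, c ∈ T k) ∧ (∀ i, i < k → ∀ c : PBond P (i + 1), c ∈ T (i + 1) → centralBond c ∈ T i) ∧
      (∀ i, i < k → ∀ b : PBond P i, b ∈ T i ↔ ∃ c ∈ T (i + 1), centralBond c = b) := by
  obtain ⟨T, hTk, hT⟩ := exists_minimal_tower_of_top P k Set.univ
  exact ⟨T, fun c => by rw [hTk]; exact Set.mem_univ c, fun i hi c hc => (hT i hi _).mpr ⟨c, hc, rfl⟩, hT⟩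

end Tower

/-! ## §2 The `k`-uniform product of the one-level weights at the d = 3 carriers -/

section Weight

variable (F : T3Family)

/-- **THE PRODUCT OF THE ONE-LEVEL CORRECTOR WEIGHTS IS `≤ 2·(L^{K−n})²` UNIFORMLY IN `k = K − n`** for the geometric smallness profile
`t_i = (10800L+1)·L^{2i}·ε₀L^{−2(K−n)}` of the iterated averages of a printed-regular field (`IterPlaqSmallAllL.plaqSmall_iter_T3_allL`), under
`10¹⁰L⁶ε₀ ≤ 1`: each factor is `L²·(1 − a_i)⁻¹` with `a_i = 925L⁴(10800L+1)ε₀·L^{2i−2(K−n)}`, `Σ_{i<k} a_i ≤ 925L⁴(10800L+1)ε₀/(L²−1) ≤ ½`, and Weierstrass'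
product inequality. [cite: Balaban1985Variational, (47)–(48) p.287] -/
theorem prod_weight_le_T3 (n K : ℕ) {ε₀ : ℝ} (hε₀ : 0 < ε₀) (hε : 10 ^ 10 * (F.L : ℝ) ^ 6 * ε₀ ≤ 1) :
    ∏ i ∈ Finset.range (K - n), (((((F.P K).L : ℝ) ^ ((F.P K).d - 1)))⁻¹
        - 148 * (stokesConst (F.P K) * ((10800 * (F.L : ℝ) + 1) * ((F.L : ℝ) ^ (2 * i) * regThreshold F n K ε₀))))⁻¹
      ≤ 2 * ((F.L : ℝ) ^ (K - n)) ^ 2 := by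
  have hd : (F.P K).d - 1 = 2 := by rw [T3Family.P_d]
  have hLL : ((F.P K).L : ℝ) = F.L := rfl
  have hL3 : (3 : ℝ) ≤ F.L := by
    have h : 3 ≤ F.L := by obtain ⟨a, ha⟩ := F.hL.1; have := F.hL.2; omega
    exact_mod_cast h
  have hL0 : (0 : ℝ) < F.L := by linarith
  set q : ℝ := (F.L : ℝ) ^ 2 with hq
  have hq9 : 9 ≤ q := by rw [hq]; nlinarith
  have hq0 : q ≠ 0 := by positivity
  rw [hd, hLL, stokesConst_T3]
  -- the profile in closed form
  have hreg : regThreshold F n K ε₀ = ε₀ * (q ^ (K - n))⁻¹ := by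
    rw [regThreshold, hq, ← pow_mul, inv_pow]
  set a : ℕ → ℝ := fun i => 925 * (F.L : ℝ) ^ 4 * (10800 * (F.L : ℝ) + 1) * ε₀ * ((q ^ (K - n))⁻¹ * q ^ i) with ha
  have ha0 : ∀ i, 0 ≤ a i := fun i => by rw [ha]; positivity
  have hfac : ∀ i, ((q)⁻¹ - 148 * (25 * (F.L : ℝ) ^ 2 / 4 * ((10800 * (F.L : ℝ) + 1) * ((F.L : ℝ) ^ (2 * i) * regThreshold F n K ε₀))))⁻¹
      = q * (1 - a i)⁻¹ := by
    intro i
    have h1 : 148 * (25 * (F.L : ℝ) ^ 2 / 4 * ((10800 * (F.L : ℝ) + 1) * ((F.L : ℝ) ^ (2 * i) * regThreshold F n K ε₀))) = q⁻¹ * a i := by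
      rw [hreg, ha, hq, pow_mul]
      field_simp
      ring
    rw [h1, ← mul_one_sub, mul_inv, inv_inv]
  rw [Finset.prod_congr rfl fun i _ => hfac i, Finset.prod_mul_distrib, Finset.prod_const, Finset.card_range, Finset.prod_inv_distrib]
  have hqk : q ^ (K - n) = ((F.L : ℝ) ^ (K - n)) ^ 2 := by rw [hq, ← pow_mul, ← pow_mul, mul_comm]
  rw [hqk, mul_comm]
  refine mul_le_mul_of_nonneg_right ?_ (by positivity)
  -- `Σ a_i ≤ 1/2`
  have hgeom : ∑ i ∈ Finset.range (K - n), q ^ i ≤ q ^ (K - n) / (q - 1) := by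
    rw [geom_sum_eq (by linarith : q ≠ 1)]
    exact div_le_div_of_nonneg_right (by linarith) (by linarith)
  have hsum : ∑ i ∈ Finset.range (K - n), a i ≤ 1 / 2 := by
    have h1 : ∑ i ∈ Finset.range (K - n), a i
        = 925 * (F.L : ℝ) ^ 4 * (10800 * (F.L : ℝ) + 1) * ε₀ * ((q ^ (K - n))⁻¹ * ∑ i ∈ Finset.range (K - n), q ^ i) := by
      rw [ha, Finset.mul_sum, Finset.mul_sum]
    have h2 : (q ^ (K - n))⁻¹ * ∑ i ∈ Finset.range (K - n), q ^ i ≤ 1 / (q - 1) := by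
      calc (q ^ (K - n))⁻¹ * ∑ i ∈ Finset.range (K - n), q ^ i ≤ (q ^ (K - n))⁻¹ * (q ^ (K - n) / (q - 1)) :=
            mul_le_mul_of_nonneg_left hgeom (by positivity)
        _ = 1 / (q - 1) := by field_simp
    have h3 : 1 / (q - 1) ≤ 1 / 8 := by
      rw [div_le_div_iff₀ (by linarith) (by norm_num)]; linarith
    have h4 : 925 * (F.L : ℝ) ^ 4 * (10800 * (F.L : ℝ) + 1) * ε₀ ≤ 925 * 10801 * ((F.L : ℝ) ^ 6 * ε₀) := by
      have : (F.L : ℝ) ^ 4 * (10800 * (F.L : ℝ) + 1) ≤ 10801 * (F.L : ℝ) ^ 6 := by nlinarith [pow_pos hL0 4, pow_pos hL0 5]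
      nlinarith [hε₀.le]
    rw [h1]
    calc 925 * (F.L : ℝ) ^ 4 * (10800 * (F.L : ℝ) + 1) * ε₀ * ((q ^ (K - n))⁻¹ * ∑ i ∈ Finset.range (K - n), q ^ i)
        ≤ (925 * 10801 * ((F.L : ℝ) ^ 6 * ε₀)) * (1 / 8) :=
          mul_le_mul h4 (h2.trans h3) (by positivity) (by positivity)
      _ ≤ 1 / 2 := by nlinarith
  have ha1 : ∀ i ∈ Finset.range (K - n), a i ≤ 1 := fun i hi =>
    ((Finset.single_le_sum (fun j _ => ha0 j) hi).trans hsum).trans (by norm_num)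
  have hW := Literature.Computability.Complexity.ProductWeights.one_sub_sum_le_prod_one_sub (Finset.range (K - n)) a (fun i _ => ha0 i) ha1
  have hP : 1 / 2 ≤ ∏ i ∈ Finset.range (K - n), (1 - a i) := by linarith
  have hPpos : 0 < ∏ i ∈ Finset.range (K - n), (1 - a i) := lt_of_lt_of_le (by norm_num) hP
  rw [inv_le_comm₀ hPpos (by norm_num)]
  linarith

end Weight

/-! ## §3 The multiplier bound at the d = 3 carriers -/

section Carrier

variable (F : T3Family) {n K : ℕ}

/-- **THE LAGRANGE-MULTIPLIER BOUND: `|Lin_U(A)| ≤ 2ε₀L^{−(K−n)}·Σ_c‖(d/ds)Γ̄₀^{(K−n)}(s)(c)|₀‖`.**  Let `U₀ ∈ 𝔘_k(ε₀)` (print's (2): plaquettes AND small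
divergence) be R2-critical in the descent fibre of `V` (a minimiser of the Wilson action over print's regular fibre (6)(e) for some `e`), `10¹⁰L⁶ε₀ ≤ 1`, and let
`Γ₀(s)` be ANY bondwise differentiable family of fine `SU(2)` fields through `U₀` with velocities `A_bU₀(b)`.  Then the first variation of the action along `A`
(the displayed plaquette sum of schema (iii) of `Prop7BlendClause1.atMostOneCriticalOrbit_of_reprSchema_T3`) is bounded by `2ε₀L^{−(K−n)}` times the `ℓ¹` norm
over the level-`(K−n)` bonds of the velocity of the `(K−n)`-fold (0.4)-average of `Γ₀` at `s = 0` — in particular it VANISHES on constraint-tangent directions.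
PROOF: minimal tower (§1) → p2's corrected lift `γ` with `Lin_{U₀}(ξ) = 0` → current identity `|Lin(A)| ≤ ε₀L^{−3(K−n)}Σ_b‖A_b − ξ_b‖` (divergence clause of (6)) →
`k`-fold corrector bound `Σ_b‖γ̇_b − Γ̇₀,b‖ ≤ ∏·Σ_c‖D_c‖` (the lift's `k`-fold average is constant) → `∏ ≤ 2L^{2(K−n)}` (§2).
[cite: Balaban1985Variational, (2), (6) p.278, (47)–(48) p.287, (127) p.297, (141)–(143) p.299; Balaban1985BackgroundPropagators, (3.11) p.392] -/
theorem abs_lin_le_constraint_velocity (hnK : n ≤ K)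
    {V : GaugeField (F.P n) 0 (Matrix.specialUnitaryGroup (Fin 2) ℂ)} {U₀ : GaugeField (F.P K) 0 (Matrix.specialUnitaryGroup (Fin 2) ℂ)}
    (hcrit : IsCritR2 F n K hnK V U₀) {ε₀ : ℝ} (hε₀ : 0 < ε₀) (hε : 10 ^ 10 * (F.L : ℝ) ^ 6 * ε₀ ≤ 1) (hU₀reg : RegPr F n K ε₀ U₀)
    (Γ₀ : ℝ → GaugeField (F.P K) 0 (Matrix.specialUnitaryGroup (Fin 2) ℂ)) (hΓ₀0 : Γ₀ 0 = U₀)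
    (A : PBond (F.P K) 0 → Matrix (Fin 2) (Fin 2) ℂ)
    (hΓ₀d : ∀ b : PBond (F.P K) 0, HasDerivAt (fun s : ℝ => (Γ₀ s b : Matrix (Fin 2) (Fin 2) ℂ)) (A b * (U₀ b : Matrix (Fin 2) (Fin 2) ℂ)) 0) :
    |∑ p : Plaq (F.P K) 0, (1 / 2) * ((((((GaugeField.plaqHol U₀ p : Matrix.specialUnitaryGroup (Fin 2) ℂ) : Matrix (Fin 2) (Fin 2) ℂ)) - 1)ᴴ
          * ((A ⟨p.src, p.μ⟩
              + (U₀ ⟨p.src, p.μ⟩ : Matrix (Fin 2) (Fin 2) ℂ) * A ⟨p.src.shift p.μ, p.ν⟩ * star (U₀ ⟨p.src, p.μ⟩ : Matrix (Fin 2) (Fin 2) ℂ)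
              - ((U₀ ⟨p.src, p.μ⟩ * U₀ ⟨p.src.shift p.μ, p.ν⟩ * (U₀ ⟨p.src.shift p.ν, p.μ⟩)⁻¹ : Matrix.specialUnitaryGroup (Fin 2) ℂ) : Matrix (Fin 2) (Fin 2) ℂ)
                  * A ⟨p.src.shift p.ν, p.μ⟩
                  * star ((U₀ ⟨p.src, p.μ⟩ * U₀ ⟨p.src.shift p.μ, p.ν⟩ * (U₀ ⟨p.src.shift p.ν, p.μ⟩)⁻¹ : Matrix.specialUnitaryGroup (Fin 2) ℂ) : Matrix (Fin 2) (Fin 2) ℂ)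
              - ((GaugeField.plaqHol U₀ p : Matrix.specialUnitaryGroup (Fin 2) ℂ) : Matrix (Fin 2) (Fin 2) ℂ) * A ⟨p.src, p.ν⟩
                  * star ((GaugeField.plaqHol U₀ p : Matrix.specialUnitaryGroup (Fin 2) ℂ) : Matrix (Fin 2) (Fin 2) ℂ))
            * ((GaugeField.plaqHol U₀ p : Matrix.specialUnitaryGroup (Fin 2) ℂ) : Matrix (Fin 2) (Fin 2) ℂ))).trace).re|
      ≤ 2 * ε₀ * ((F.L : ℝ) ^ (K - n))⁻¹ * ∑ c : PBond (F.P K) (K - n),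
          ‖deriv (fun s : ℝ => ((Averaging.iter (fun i => blockAvg (P := F.P K) (j := i) (expMeanLogSU (n := Fin 2))) (K - n) (Γ₀ s) c :
              Matrix.specialUnitaryGroup (Fin 2) ℂ) : Matrix (Fin 2) (Fin 2) ℂ)) 0‖ := by
  classical
  -- the minimal tower and p2's corrected lift with its velocity and the Euler–Lagrange equation
  obtain ⟨T, hTk, hTcl, hTmin⟩ := exists_minimal_tower (F.P K) (K - n)
  obtain ⟨γ, ξ, hγ0, hγdiff, hγfib, hξd, hγT, hlin⟩ := exists_fibre_curve_lin_eq_zero_of_isCritR2 F hnK hcrit hε₀ hε hU₀reg T hTcl hTk Γ₀ hΓ₀0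
    (fun b => (hΓ₀d b).differentiableAt)
  -- (a) `|Lin(A)| ≤ ε₀ (L^{K−n})⁻³ Σ_b ‖A_b − ξ_b‖` (current identity + divergence clause)
  have hUU : ∀ b : PBond (F.P K) 0, (U₀ b : Matrix (Fin 2) (Fin 2) ℂ) * star (U₀ b : Matrix (Fin 2) (Fin 2) ℂ) = 1 :=
    fun b => Matrix.mem_unitaryGroup_iff.mp (U₀ b).2.1
  have hstep1 : |∑ p : Plaq (F.P K) 0, (1 / 2) * ((((((GaugeField.plaqHol U₀ p : Matrix.specialUnitaryGroup (Fin 2) ℂ) : Matrix (Fin 2) (Fin 2) ℂ)) - 1)ᴴ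
          * ((A ⟨p.src, p.μ⟩
              + (U₀ ⟨p.src, p.μ⟩ : Matrix (Fin 2) (Fin 2) ℂ) * A ⟨p.src.shift p.μ, p.ν⟩ * star (U₀ ⟨p.src, p.μ⟩ : Matrix (Fin 2) (Fin 2) ℂ)
              - ((U₀ ⟨p.src, p.μ⟩ * U₀ ⟨p.src.shift p.μ, p.ν⟩ * (U₀ ⟨p.src.shift p.ν, p.μ⟩)⁻¹ : Matrix.specialUnitaryGroup (Fin 2) ℂ) : Matrix (Fin 2) (Fin 2) ℂ)
                  * A ⟨p.src.shift p.ν, p.μ⟩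
                  * star ((U₀ ⟨p.src, p.μ⟩ * U₀ ⟨p.src.shift p.μ, p.ν⟩ * (U₀ ⟨p.src.shift p.ν, p.μ⟩)⁻¹ : Matrix.specialUnitaryGroup (Fin 2) ℂ) : Matrix (Fin 2) (Fin 2) ℂ)
              - ((GaugeField.plaqHol U₀ p : Matrix.specialUnitaryGroup (Fin 2) ℂ) : Matrix (Fin 2) (Fin 2) ℂ) * A ⟨p.src, p.ν⟩
                  * star ((GaugeField.plaqHol U₀ p : Matrix.specialUnitaryGroup (Fin 2) ℂ) : Matrix (Fin 2) (Fin 2) ℂ))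
            * ((GaugeField.plaqHol U₀ p : Matrix.specialUnitaryGroup (Fin 2) ℂ) : Matrix (Fin 2) (Fin 2) ℂ))).trace).re|
      ≤ ε₀ * (((F.L : ℝ) ^ (K - n)) ^ 3)⁻¹ * ∑ b : PBond (F.P K) 0, ‖A b - ξ b‖ := by
    have hUreg3 : DivSmall F n K ε₀ U₀ := hU₀reg.2
    rw [← sub_zero (∑ p : Plaq (F.P K) 0, _), ← hlin, lin_eq_neg_half_sum_re_trace_mul_covDivT, lin_eq_neg_half_sum_re_trace_mul_covDivT, ← mul_sub,
      ← Finset.sum_sub_distrib]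
    have hsub : ∀ b : PBond (F.P K) 0,
        ((A b * covDivT 1 (unitsField (toUField U₀)) b.dir b.src).trace).re - ((ξ b * covDivT 1 (unitsField (toUField U₀)) b.dir b.src).trace).re
          = (((A b - ξ b) * covDivT 1 (unitsField (toUField U₀)) b.dir b.src).trace).re := by
      intro b; rw [Matrix.sub_mul, Matrix.trace_sub, Complex.sub_re]
    simp only [hsub]
    have hpow : ((F.L : ℝ)⁻¹) ^ (3 * (K - n)) = (((F.L : ℝ) ^ (K - n)) ^ 3)⁻¹ := by rw [inv_pow, mul_comm, pow_mul]
    have hb : ∀ b : PBond (F.P K) 0, |(((A b - ξ b) * covDivT 1 (unitsField (toUField U₀)) b.dir b.src).trace).re|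
        ≤ 2 * (‖A b - ξ b‖ * (ε₀ * (((F.L : ℝ) ^ (K - n)) ^ 3)⁻¹)) := by
      intro b
      have h1 := abs_re_trace_le ((A b - ξ b) * covDivT 1 (unitsField (toUField U₀)) b.dir b.src)
      have hJ : ‖covDivT 1 (unitsField (toUField U₀)) b.dir b.src‖ ≤ ε₀ * (((F.L : ℝ) ^ (K - n)) ^ 3)⁻¹ := by rw [← hpow]; exact (hUreg3 b).le
      calc |(((A b - ξ b) * covDivT 1 (unitsField (toUField U₀)) b.dir b.src).trace).re|
          ≤ 2 * ‖(A b - ξ b) * covDivT 1 (unitsField (toUField U₀)) b.dir b.src‖ := by simpa using h1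
        _ ≤ 2 * (‖A b - ξ b‖ * (ε₀ * (((F.L : ℝ) ^ (K - n)) ^ 3)⁻¹)) :=
            mul_le_mul_of_nonneg_left ((norm_mul_le _ _).trans (mul_le_mul_of_nonneg_left hJ (norm_nonneg _))) (by norm_num)
    rw [abs_mul, abs_neg, abs_of_pos (by norm_num : (0 : ℝ) < 1 / 2)]
    calc (1 / 2) * |∑ b : PBond (F.P K) 0, (((A b - ξ b) * covDivT 1 (unitsField (toUField U₀)) b.dir b.src).trace).re|
        ≤ (1 / 2) * ∑ b : PBond (F.P K) 0, 2 * (‖A b - ξ b‖ * (ε₀ * (((F.L : ℝ) ^ (K - n)) ^ 3)⁻¹)) :=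
          mul_le_mul_of_nonneg_left ((Finset.abs_sum_le_sum_abs _ _).trans (Finset.sum_le_sum fun b _ => hb b)) (by norm_num)
      _ = ε₀ * (((F.L : ℝ) ^ (K - n)) ^ 3)⁻¹ * ∑ b : PBond (F.P K) 0, ‖A b - ξ b‖ := by
          rw [← Finset.mul_sum, ← Finset.sum_mul]; ring
  -- (b) `‖A_b − ξ_b‖ = ‖γ̇_b − Γ̇₀,b‖`
  have hAξ : ∀ b : PBond (F.P K) 0, ‖A b - ξ b‖
      = ‖deriv (fun s : ℝ => ((γ s b : Matrix.specialUnitaryGroup (Fin 2) ℂ) : Matrix (Fin 2) (Fin 2) ℂ)) 0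
          - deriv (fun s : ℝ => ((Γ₀ s b : Matrix.specialUnitaryGroup (Fin 2) ℂ) : Matrix (Fin 2) (Fin 2) ℂ)) 0‖ := by
    intro b
    have h1 : ξ b = deriv (fun s : ℝ => ((γ s b : Matrix.specialUnitaryGroup (Fin 2) ℂ) : Matrix (Fin 2) (Fin 2) ℂ)) 0 * star (U₀ b : Matrix (Fin 2) (Fin 2) ℂ) :=
      (hξd b).unique ((hγdiff b).hasDerivAt.mul_const _)
    have h2 : A b = deriv (fun s : ℝ => ((Γ₀ s b : Matrix.specialUnitaryGroup (Fin 2) ℂ) : Matrix (Fin 2) (Fin 2) ℂ)) 0 * star (U₀ b : Matrix (Fin 2) (Fin 2) ℂ) := by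
      rw [(hΓ₀d b).deriv, mul_assoc, hUU b, mul_one]
    rw [h1, h2, ← sub_mul, CStarRing.norm_mul_mem_unitary _ (Unitary.star_mem (U₀ b).2.1), norm_sub_rev]
  -- (c) the `k`-fold corrector bound with the geometric profile
  obtain ⟨ht₀, hsmall, -⟩ := t0_data_of_regPr_allL F hε₀ hε hU₀reg
  have hL3 : (3 : ℝ) ≤ F.L := by
    have h : 3 ≤ F.L := by obtain ⟨a, ha⟩ := F.hL.1; have := F.hL.2; omega
    exact_mod_cast h
  have hL0 : (0 : ℝ) < F.L := by linarith
  have hε7 : 10 ^ 7 * (F.L : ℝ) ^ 3 * ε₀ ≤ 1 := by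
    refine le_trans ?_ hε
    have hL36 : (F.L : ℝ) ^ 3 ≤ (F.L : ℝ) ^ 6 := pow_le_pow_right₀ (by linarith) (by norm_num)
    have : (10 : ℝ) ^ 7 * (F.L : ℝ) ^ 3 ≤ 10 ^ 10 * (F.L : ℝ) ^ 6 := by nlinarith [pow_pos hL0 3]
    exact mul_le_mul_of_nonneg_right this hε₀.le
  have hv24 : stokesConst (F.P K) * ((10800 * (F.L : ℝ) + 1) * ε₀) ≤ 1 / 24 := by
    have := emlWeight_le_one (F.P K); linarith
  have ht0 : ∀ i : ℕ, 0 < (10800 * (F.L : ℝ) + 1) * ((F.L : ℝ) ^ (2 * i) * regThreshold F n K ε₀) := fun i => by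
    have : 0 < regThreshold F n K ε₀ := by unfold regThreshold; positivity
    positivity
  have hreg : ∀ i : ℕ, i < K - n → (F.L : ℝ) ^ (2 * i) * regThreshold F n K ε₀ ≤ ε₀ := by
    intro i hi
    rw [regThreshold, inv_pow, mul_left_comm, ← div_eq_mul_inv]
    refine mul_le_of_le_one_right hε₀.le ?_
    rw [div_le_one (by positivity)]
    exact pow_le_pow_right₀ (by linarith) (by omega)
  have htle : ∀ i : ℕ, i < K - n → (10800 * (F.L : ℝ) + 1) * ((F.L : ℝ) ^ (2 * i) * regThreshold F n K ε₀) ≤ (10800 * (F.L : ℝ) + 1) * ε₀ :=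
    fun i hi => mul_le_mul_of_nonneg_left (hreg i hi) (by positivity)
  have hρ : ∀ i : ℕ, i < K - n → 148 * (stokesConst (F.P K) * ((10800 * (F.L : ℝ) + 1) * ((F.L : ℝ) ^ (2 * i) * regThreshold F n K ε₀)))
      < (((((F.P K).L : ℝ) ^ ((F.P K).d - 1)))⁻¹) := by
    intro i hi
    have hd : (F.P K).d - 1 = 2 := by rw [T3Family.P_d]
    rw [hd, stokesConst_T3]
    show _ < (((F.L : ℝ) ^ 2))⁻¹
    have h1 : 148 * (25 * (F.L : ℝ) ^ 2 / 4 * ((10800 * (F.L : ℝ) + 1) * ((F.L : ℝ) ^ (2 * i) * regThreshold F n K ε₀)))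
        ≤ 925 * (F.L : ℝ) ^ 2 * ((10800 * (F.L : ℝ) + 1) * ε₀) := by
      have := htle i hi
      nlinarith [pow_pos hL0 2]
    have h2 : 925 * (F.L : ℝ) ^ 2 * ((10800 * (F.L : ℝ) + 1) * ε₀) < (((F.L : ℝ) ^ 2))⁻¹ := by
      rw [← one_div, lt_div_iff₀ (by positivity)]
      have h5 : (F.L : ℝ) ^ 4 * (10800 * (F.L : ℝ) + 1) ≤ 10801 * (F.L : ℝ) ^ 6 := by nlinarith [pow_pos hL0 4, pow_pos hL0 5]
      have h6 : 925 * (F.L : ℝ) ^ 2 * ((10800 * (F.L : ℝ) + 1) * ε₀) * (F.L : ℝ) ^ 2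
          = 925 * ((F.L : ℝ) ^ 4 * (10800 * (F.L : ℝ) + 1)) * ε₀ := by ring
      rw [h6]
      nlinarith [pow_pos hL0 6, hε₀]
    exact lt_of_le_of_lt h1 h2
  have hk : K - n ≤ (F.P K).m + (F.P K).K := by show K - n ≤ F.m + K; omega
  have hsm : ∀ i, i < K - n → PlaqSmall ((10800 * (F.L : ℝ) + 1) * ((F.L : ℝ) ^ (2 * i) * regThreshold F n K ε₀))
      (Averaging.iter (fun i => blockAvg (P := F.P K) (j := i) (expMeanLogSU (n := Fin 2))) i (Γ₀ 0)) := by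
    intro i hi; rw [hΓ₀0]; exact plaqSmall_iter_T3_allL F n K hε₀ hε7 U₀ hU₀reg.1 i hi.le
  have hγΓ0 : γ 0 = Γ₀ 0 := by rw [hγ0, hΓ₀0]
  have hB := sum_norm_deriv_sub_le_prod (P := F.P K) (t := fun i => (10800 * (F.L : ℝ) + 1) * ((F.L : ℝ) ^ (2 * i) * regThreshold F n K ε₀))
    ht₀ hv24 ht0 (K - n) hk htle hρ Γ₀ γ (fun b => (hΓ₀d b).differentiableAt) hγdiff hγΓ0 hsm T hTmin hγT
  -- (d) the lift's `k`-fold average is constant `= Ū₀^{(k)}`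
  have hU₀fib : U₀ ∈ fibre F ℰp n K hnK V := by
    obtain ⟨e, -, hreg', -⟩ := hcrit
    exact ((mem_regFibrePr_iff (F := F)).mp hreg').1
  have hconst : ∀ c : PBond (F.P K) (K - n),
      deriv (fun s : ℝ => ((Averaging.iter (fun i => blockAvg (P := F.P K) (j := i) (expMeanLogSU (n := Fin 2))) (K - n) (γ s) c :
        Matrix.specialUnitaryGroup (Fin 2) ℂ) : Matrix (Fin 2) (Fin 2) ℂ)) 0 = 0 := by
    intro c
    have hev : (fun s : ℝ => ((Averaging.iter (fun i => blockAvg (P := F.P K) (j := i) (expMeanLogSU (n := Fin 2))) (K - n) (γ s) c :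
        Matrix.specialUnitaryGroup (Fin 2) ℂ) : Matrix (Fin 2) (Fin 2) ℂ)) =ᶠ[𝓝 0]
        fun _ => ((Averaging.iter (fun i => blockAvg (P := F.P K) (j := i) (expMeanLogSU (n := Fin 2))) (K - n) U₀ c :
          Matrix.specialUnitaryGroup (Fin 2) ℂ) : Matrix (Fin 2) (Fin 2) ℂ) := by
      filter_upwards [hγfib] with s hs
      rw [mem_fibre_iff] at hs hU₀fib
      have h1 := congrArg (fieldShift (F.sitesPerDir_eq (m := F.m) (K := n) (j := 0) (m' := F.m) (K' := K) (j' := K - n) (by omega)).symm) (hs.trans hU₀fib.symm)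
      rw [descendTo, descendTo, fieldShift_fieldShift_symm, fieldShift_fieldShift_symm] at h1
      rw [h1]
    rw [hev.deriv_eq, deriv_const]
  simp only [hconst, zero_sub, norm_neg] at hB
  -- (e) assembly
  have hW := prod_weight_le_T3 F n K hε₀ hε
  have hS0 : 0 ≤ ∑ c : PBond (F.P K) (K - n), ‖deriv (fun s : ℝ => ((Averaging.iter (fun i => blockAvg (P := F.P K) (j := i) (expMeanLogSU (n := Fin 2))) (K - n) (Γ₀ s) c :
      Matrix.specialUnitaryGroup (Fin 2) ℂ) : Matrix (Fin 2) (Fin 2) ℂ)) 0‖ := Finset.sum_nonneg fun c _ => norm_nonneg _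
  have hLk : 0 < (F.L : ℝ) ^ (K - n) := by positivity
  calc _ ≤ ε₀ * (((F.L : ℝ) ^ (K - n)) ^ 3)⁻¹ * ∑ b : PBond (F.P K) 0, ‖A b - ξ b‖ := hstep1
    _ = ε₀ * (((F.L : ℝ) ^ (K - n)) ^ 3)⁻¹ * ∑ b : PBond (F.P K) 0,
          ‖deriv (fun s : ℝ => ((γ s b : Matrix.specialUnitaryGroup (Fin 2) ℂ) : Matrix (Fin 2) (Fin 2) ℂ)) 0
            - deriv (fun s : ℝ => ((Γ₀ s b : Matrix.specialUnitaryGroup (Fin 2) ℂ) : Matrix (Fin 2) (Fin 2) ℂ)) 0‖ := by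
        simp only [hAξ]
    _ ≤ ε₀ * (((F.L : ℝ) ^ (K - n)) ^ 3)⁻¹ * ((2 * ((F.L : ℝ) ^ (K - n)) ^ 2) * ∑ c : PBond (F.P K) (K - n),
          ‖deriv (fun s : ℝ => ((Averaging.iter (fun i => blockAvg (P := F.P K) (j := i) (expMeanLogSU (n := Fin 2))) (K - n) (Γ₀ s) c :
              Matrix.specialUnitaryGroup (Fin 2) ℂ) : Matrix (Fin 2) (Fin 2) ℂ)) 0‖) :=
        mul_le_mul_of_nonneg_left (hB.trans (mul_le_mul_of_nonneg_right hW hS0)) (by positivity)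
    _ = 2 * ε₀ * ((F.L : ℝ) ^ (K - n))⁻¹ * ∑ c : PBond (F.P K) (K - n),
          ‖deriv (fun s : ℝ => ((Averaging.iter (fun i => blockAvg (P := F.P K) (j := i) (expMeanLogSU (n := Fin 2))) (K - n) (Γ₀ s) c :
              Matrix.specialUnitaryGroup (Fin 2) ℂ) : Matrix (Fin 2) (Fin 2) ℂ)) 0‖ := by
        field_simp

end Carrier

end Summit.QuantumFields.YangMills.Theorems.Prop7FirstVariationMultiplier

end
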